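import Summits.RiemannHypothesis.RiemannHypothesis.Theorems.MotivicDoorSemilocalMarkov
import Summits.RiemannHypothesis.RiemannHypothesis.Theorems.SemilocalListPoly
import HarnessLib

/-!
# Semi-local threshold, negative side — GENERIC polynomial Markov witnesses (exact rational bookkeeping)

Cell `rh-explicit` (HOME `run/shared/lean/pub/rh-explicit/`), seat cc-s2-4 (`HOME/cc-s2-4/CC4-THRESHOLD-PLAN.md` §2).
Honest framing: bookkeeping for NEGATIVE certificates about the tree's object `weilSemilocalThreshold {2}`
(consolation-prize side of the motivic door; nothing here bears on RH).

The rung R3⁻(0.57) of seat lad-2 (`MotivicDoorSemilocalUndecicWitness.lean`) certifies ONE odd polynomial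
witness `G = p(x/b)·1_{[−b,b]}` with a hand-expanded coefficient table (`cjU`, 23 polynomials in `τ`, checked
by `ring` at `maxHeartbeats 4000000`).  For the sharper rungs planned by the cell (degree ≈ 30, margins
`1e-5 … 1e-6`, cc-s2-2 MEMO §4) that pattern does not scale and is per-witness.  This file makes the
bookkeeping GENERIC and COMPUTABLE: for ANY coefficient list `p : List ℚ` and ANY rational `b > 0`,

* `LQ.*`: list polynomials over `ℚ` (Horner evaluation into `ℝ`, `add`, `smul`, `mul`, `pow`, antiderivative)
  and list-of-list bivariate polynomials (`evalB`, the Taylor shift `shiftB : p ↦ p(x + t)`, the product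
  `mulUB : p(x)·Q(x,t)`, the definite `x`-integral `intB` between polynomial limits), each with its evaluation
  theorem — all `def`s reduce in the kernel, so every later certificate check is `decide` over `ℚ`;
* `polyWitness p b` : the function `x ↦ p(x)·1_{[−b,b]}(x)` (complex-valued), and, for `p` odd
  (`LQ.isOddList p = true`): `isMarkovWitness_polyWitness` (with the explicit bound `LQ.absBound p b`),
  `integral_norm_sq_polyWitness` (`‖G‖² = LQ.normSq p b`, a rational number), and the INCREMENT IDENTITY
  `weilIncrement_polyWitness_eq`: for `0 ≤ t ≤ 2b`, `D_t(G) = 2‖G‖² − 2·κ(t)` with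
  `κ = LQ.ev (kappaL p b)`, `kappaL p b := intB (mulUB p (shiftB p)) [−b] [b, −1]` an explicit rational
  coefficient list (`∫_{−b}^{b−t} p(x+t)p(x) dx`), and `D_t(G) = 2‖G‖²` for `t > 2b`.

So a rung's Lean data is `(p, b)` and nothing else; the increment polynomial is COMPUTED, not transcribed.
References: E. Bombieri, Rend. Mat. Acc. Lincei (9) 11 (2000) Thm 2 (the jump form of `W_∞`); lad-2's files
cited above for the criterion this feeds (`IsMarkovWitness.not_weilSemilocalPositivityOn_two_polar`).
-/

set_option linter.dupNamespace false  -- the mandated namespace repeats `RiemannHypothesis`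

open MeasureTheory Set Filter Topology Real Finset
open Literature.NumberTheory.LFunctions
open Summit.RiemannHypothesis.RiemannHypothesis.Theorems.MotivicDoor

namespace Summit.RiemannHypothesis.RiemannHypothesis.Theorems.SemilocalPolyWitness

/-! ## §B  The polynomial witness `G = p·1_{[−b,b]}` -/

open LQ

section Witness

variable (p : List ℚ) (b : ℚ)

/-- The real witness `g(x) = p(x)·1_{[−b,b]}(x)`. -/
noncomputable def polyWitnessRe (x : ℝ) : ℝ := (Icc (-(b : ℝ)) b).indicator (ev p) x

/-- The witness as a complex-valued function. -/
noncomputable def polyWitness (x : ℝ) : ℂ := (polyWitnessRe p b x : ℂ)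

/-- `‖G‖² = ∫_{−b}^{b} p²` as a rational number. -/
def LQ.normSq : ℚ := evQ (integ (mul p p)) b - evQ (integ (mul p p)) (-b)

/-- The autocorrelation list `κ(t) = ∫_{−b}^{b−t} p(x+t) p(x) dx` (coefficients in `t`). -/
def kappaL : List ℚ := intB (mulUB p (shiftB p)) [-b] [b, -1]

variable {p b}

/-- The witness vanishes off `[−b, b]`. -/
theorem polyWitnessRe_of_not_mem {x : ℝ} (hx : x ∉ Icc (-(b : ℝ)) b) : polyWitnessRe p b x = 0 := by
  simp [polyWitnessRe, indicator_of_notMem hx]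

/-- The witness is `p` on `[−b, b]`. -/
theorem polyWitnessRe_of_mem {x : ℝ} (hx : x ∈ Icc (-(b : ℝ)) b) : polyWitnessRe p b x = ev p x := by
  simp [polyWitnessRe, indicator_of_mem hx]

/-- `|g| ≤ absBound p b`. -/
theorem abs_polyWitnessRe_le (hb : 0 < b) (x : ℝ) : |polyWitnessRe p b x| ≤ (absBound p b : ℝ) := by
  by_cases hx : x ∈ Icc (-(b : ℝ)) b
  · rw [polyWitnessRe_of_mem hx]
    exact abs_ev_le_absBound p (abs_le.2 hx)
  · rw [polyWitnessRe_of_not_mem hx, abs_zero]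
    exact_mod_cast absBound_nonneg p hb.le

/-- `g` is odd when `p` is. -/
theorem polyWitnessRe_neg (hp : isOddList p = true) (x : ℝ) : polyWitnessRe p b (-x) = -polyWitnessRe p b x := by
  by_cases hx : x ∈ Icc (-(b : ℝ)) b
  · have hx' : -x ∈ Icc (-(b : ℝ)) b := by
      rw [Set.mem_Icc] at hx ⊢; constructor <;> linarith [hx.1, hx.2]
    rw [polyWitnessRe_of_mem hx, polyWitnessRe_of_mem hx', ev_neg_of_isOddList hp]
  · have hx' : -x ∉ Icc (-(b : ℝ)) b := fun h ↦ hx (by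
      rw [Set.mem_Icc] at h ⊢; constructor <;> linarith [h.1, h.2])
    rw [polyWitnessRe_of_not_mem hx, polyWitnessRe_of_not_mem hx', neg_zero]

/-- `g` is measurable. -/
theorem measurable_polyWitnessRe : Measurable (polyWitnessRe p b) :=
  (continuous_ev p).measurable.indicator measurableSet_Icc

/-- `‖G x‖ = |g x|`. -/
theorem norm_polyWitness (x : ℝ) : ‖polyWitness p b x‖ = |polyWitnessRe p b x| := by
  rw [polyWitness, Complex.norm_real, Real.norm_eq_abs]

/-- **An odd polynomial window is a Markov witness** (`M = absBound p b`). -/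
theorem isMarkovWitness_polyWitness (hp : isOddList p = true) (hb : 0 < b) :
    SemilocalMarkov.IsMarkovWitness (polyWitness p b) b (absBound p b) := by
  refine SemilocalMarkov.IsMarkovWitness.intro (Complex.measurable_ofReal.comp measurable_polyWitnessRe)
    (fun x ↦ by rw [norm_polyWitness]; exact abs_polyWitnessRe_le hb x) (fun x hx ↦ ?_) (fun x ↦ ?_) ?_
    (by exact_mod_cast hb)
  · have : x ∉ Icc (-(b : ℝ)) b := fun h ↦ by
      rw [Set.mem_Icc] at h; exact (abs_le.2 h).not_gt hx
    simp [polyWitness, polyWitnessRe_of_not_mem this]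
  · simp [polyWitness, polyWitnessRe_neg hp]
  · have h0 : volume ({-(b : ℝ), (b : ℝ)} : Set ℝ) = 0 :=
      (Set.toFinite ({-(b : ℝ), (b : ℝ)} : Set ℝ)).measure_zero volume
    refine (measure_eq_zero_iff_ae_notMem.1 h0).mono fun x hx ↦ ?_
    simp only [mem_insert_iff, mem_singleton_iff, not_or] at hx
    by_cases h : x ∈ Ioo (-(b : ℝ)) b
    · have hev : (fun y ↦ ((ev p y : ℝ) : ℂ)) =ᶠ[𝓝 x] polyWitness p b := by
        filter_upwards [Ioo_mem_nhds h.1 h.2] with y hy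
        simp [polyWitness, polyWitnessRe_of_mem (Ioo_subset_Icc_self hy)]
      exact ((Complex.continuous_ofReal.comp (continuous_ev p)).continuousAt).congr hev
    · have hout : x ∉ Icc (-(b : ℝ)) b := fun hm ↦
        h ⟨lt_of_le_of_ne hm.1 (Ne.symm hx.1), lt_of_le_of_ne hm.2 hx.2⟩
      have hev : (fun _ ↦ (0 : ℂ)) =ᶠ[𝓝 x] polyWitness p b := by
        filter_upwards [isClosed_Icc.isOpen_compl.mem_nhds hout] with y hy
        simp [polyWitness, polyWitnessRe_of_not_mem hy]
      exact continuousAt_const.congr hev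

/-! ### `‖G‖²` -/

/-- `∫ g² = normSq p b`. -/
theorem integral_polyWitnessRe_sq (hb : 0 < b) :
    ∫ x, polyWitnessRe p b x ^ 2 = (LQ.normSq p b : ℝ) := by
  have hb' : (0 : ℝ) < b := by exact_mod_cast hb
  rw [← setIntegral_eq_integral_of_forall_compl_eq_zero (s := Icc (-(b : ℝ)) b)
    (fun x hx ↦ by rw [polyWitnessRe_of_not_mem hx]; ring)]
  rw [setIntegral_congr_fun measurableSet_Icc
    (fun x hx ↦ by simp only [polyWitnessRe_of_mem hx] :
      EqOn (fun x ↦ polyWitnessRe p b x ^ 2) (fun x ↦ ev p x ^ 2) (Icc (-(b : ℝ)) b))]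
  rw [integral_Icc_eq_integral_Ioc, ← intervalIntegral.integral_of_le (by linarith)]
  have e : (fun x ↦ ev p x ^ 2) = fun x ↦ ev (mul p p) x := by
    funext x; rw [ev_mul, sq]
  rw [e, integral_ev, LQ.normSq]
  push_cast
  rw [ev_ratCast, ← Rat.cast_neg, ev_ratCast]

/-- `‖G‖² = normSq p b`. -/
theorem integral_norm_sq_polyWitness (hb : 0 < b) :
    ∫ x, ‖polyWitness p b x‖ ^ 2 = (LQ.normSq p b : ℝ) := by
  rw [← integral_polyWitnessRe_sq hb]
  exact integral_congr_ae (Eventually.of_forall fun x ↦ by simp only [norm_polyWitness, sq_abs])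

/-! ### The increment identity -/

/-- For `t ≥ 0`, `g(x+t) g(x) = p(x+t) p(x) 1_{[-b, b-t]}(x)`. -/
theorem polyWitnessRe_shift_mul {t : ℝ} (ht : 0 ≤ t) (x : ℝ) :
    polyWitnessRe p b (x + t) * polyWitnessRe p b x
      = (Icc (-(b : ℝ)) (b - t)).indicator (fun x ↦ ev p (x + t) * ev p x) x := by
  by_cases hx : x ∈ Icc (-(b : ℝ)) (b - t)
  · have h1 : x ∈ Icc (-(b : ℝ)) b := ⟨hx.1, by linarith [hx.2]⟩
    have h2 : x + t ∈ Icc (-(b : ℝ)) b := ⟨by linarith [hx.1], by linarith [hx.2]⟩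
    rw [polyWitnessRe_of_mem h2, polyWitnessRe_of_mem h1, indicator_of_mem hx]
  · rw [indicator_of_notMem hx]
    rw [Set.mem_Icc, not_and_or, not_le, not_le] at hx
    rcases hx with h | h
    · rw [polyWitnessRe_of_not_mem (x := x) (fun h' ↦ by linarith [h'.1]), mul_zero]
    · rw [polyWitnessRe_of_not_mem (x := x + t) (fun h' ↦ by linarith [h'.2]), zero_mul]

/-- **The autocorrelation is the list polynomial `kappaL`** for `0 ≤ t ≤ 2b`. -/
theorem integral_polyWitnessRe_shift_mul {t : ℝ} (ht0 : 0 ≤ t) (ht : t ≤ 2 * b) :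
    ∫ x, polyWitnessRe p b (x + t) * polyWitnessRe p b x = ev (kappaL p b) t := by
  simp_rw [polyWitnessRe_shift_mul ht0]
  rw [integral_indicator measurableSet_Icc, integral_Icc_eq_integral_Ioc,
    ← intervalIntegral.integral_of_le (by linarith)]
  have e : ∀ x, ev p (x + t) * ev p x = evalB (mulUB p (shiftB p)) x t := fun x ↦ by
    rw [evalB_mulUB, evalB_shiftB, mul_comm]
  simp_rw [e]
  have hu : ev [-b] t = -(b : ℝ) := by simp
  have hv : ev [b, -1] t = (b : ℝ) - t := by simp; ring
  rw [← hu, ← hv, integral_evalB, kappaL]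

/-- The autocorrelation vanishes for `t > 2b` (disjoint supports). -/
theorem integral_polyWitnessRe_shift_mul_of_lt {t : ℝ} (ht : 2 * (b : ℝ) < t) :
    ∫ x, polyWitnessRe p b (x + t) * polyWitnessRe p b x = 0 := by
  refine integral_eq_zero_of_ae (Eventually.of_forall fun x ↦ ?_)
  by_cases hx : x ∈ Icc (-(b : ℝ)) b
  · have : x + t ∉ Icc (-(b : ℝ)) b := fun h ↦ by
      have := h.2; have := hx.1; linarith
    simp [polyWitnessRe_of_not_mem this]
  · simp [polyWitnessRe_of_not_mem hx]

/-- `x ↦ g(x+t) g(x)` is integrable. -/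
theorem integrable_polyWitnessRe_shift_mul (hb : 0 < b) (t : ℝ) :
    Integrable fun x ↦ polyWitnessRe p b (x + t) * polyWitnessRe p b x := by
  refine SemilocalMarkov.integrable_of_norm_le_of_eq_zero (C := (absBound p b : ℝ) * absBound p b) (R := b)
    ((measurable_polyWitnessRe.comp (measurable_id.add_const t)).mul measurable_polyWitnessRe).aestronglyMeasurable
    (fun x ↦ ?_) (fun x hx ↦ ?_)
  · rw [norm_mul, Real.norm_eq_abs, Real.norm_eq_abs]
    exact mul_le_mul (abs_polyWitnessRe_le hb _) (abs_polyWitnessRe_le hb _) (abs_nonneg _)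
      (by exact_mod_cast absBound_nonneg p hb.le)
  · have : x ∉ Icc (-(b : ℝ)) b := fun h ↦ by
      rw [Set.mem_Icc] at h; exact (abs_le.2 h).not_gt hx
    rw [polyWitnessRe_of_not_mem this, mul_zero]

/-- `x ↦ g(x)²` is integrable. -/
theorem integrable_polyWitnessRe_sq (hp : isOddList p = true) (hb : 0 < b) :
    Integrable fun x ↦ polyWitnessRe p b x ^ 2 := by
  have := (isMarkovWitness_polyWitness hp hb).integrable_norm_sq
  refine this.congr (Eventually.of_forall fun x ↦ ?_)
  simp only [norm_polyWitness, sq_abs]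

/-- Polarisation: `D_t(G) = 2‖G‖² − 2 ∫ g(x+t) g(x) dx`. -/
theorem weilIncrement_polyWitness (hp : isOddList p = true) (hb : 0 < b) (t : ℝ) :
    weilIncrement (polyWitness p b) t
      = 2 * (LQ.normSq p b : ℝ) - 2 * ∫ x, polyWitnessRe p b (x + t) * polyWitnessRe p b x := by
  unfold weilIncrement
  have e : ∀ x, ‖polyWitness p b (x + t) - polyWitness p b x‖ ^ 2
      = polyWitnessRe p b (x + t) ^ 2 + polyWitnessRe p b x ^ 2
          - 2 * (polyWitnessRe p b (x + t) * polyWitnessRe p b x) := fun x ↦ by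
    rw [polyWitness, polyWitness, ← Complex.ofReal_sub, Complex.norm_real, Real.norm_eq_abs, sq_abs]; ring
  simp_rw [e]
  have h2 := integrable_polyWitnessRe_sq hp hb
  have h1 : Integrable fun x ↦ polyWitnessRe p b (x + t) ^ 2 := h2.comp_add_right t
  have h3 := integrable_polyWitnessRe_shift_mul (p := p) hb t
  have h12 : Integrable fun x ↦ polyWitnessRe p b (x + t) ^ 2 + polyWitnessRe p b x ^ 2 := h1.add h2
  have h3' : Integrable fun x ↦ 2 * (polyWitnessRe p b (x + t) * polyWitnessRe p b x) := h3.const_mul 2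
  rw [integral_sub h12 h3', integral_add h1 h2, integral_const_mul,
    integral_add_right_eq_self (fun x ↦ polyWitnessRe p b x ^ 2) t, integral_polyWitnessRe_sq hb]
  ring

/-- **INCREMENT IDENTITY**: `D_t(G) = 2‖G‖² − 2κ(t)` with `κ = ev (kappaL p b)`, for `0 ≤ t ≤ 2b`. -/
theorem weilIncrement_polyWitness_eq (hp : isOddList p = true) (hb : 0 < b) {t : ℝ} (ht0 : 0 ≤ t)
    (ht : t ≤ 2 * b) :
    weilIncrement (polyWitness p b) t = 2 * (LQ.normSq p b : ℝ) - 2 * ev (kappaL p b) t := by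
  rw [weilIncrement_polyWitness hp hb, integral_polyWitnessRe_shift_mul ht0 ht]

/-- `D_t(G) = 2‖G‖²` for `t > 2b`. -/
theorem weilIncrement_polyWitness_eq_of_lt (hp : isOddList p = true) (hb : 0 < b) {t : ℝ}
    (ht : 2 * (b : ℝ) < t) : weilIncrement (polyWitness p b) t = 2 * (LQ.normSq p b : ℝ) := by
  rw [weilIncrement_polyWitness hp hb, integral_polyWitnessRe_shift_mul_of_lt ht]; ring

/-- The increment polynomial written as ONE list: `D(t) = ev (incrementL p b) t` on `[0, 2b]`. -/
def incrementL (p : List ℚ) (b : ℚ) : List ℚ := add [2 * LQ.normSq p b] (smul (-2) (kappaL p b))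

/-- Evaluation of the increment list. -/
theorem ev_incrementL (p : List ℚ) (b : ℚ) (t : ℝ) :
    ev (incrementL p b) t = 2 * (LQ.normSq p b : ℝ) - 2 * ev (kappaL p b) t := by
  rw [incrementL, ev_add, ev_smul, ev_cons, ev_nil]; push_cast; ring

/-- **INCREMENT IDENTITY, list form**: `D_t(G) = ev (incrementL p b) t` for `0 ≤ t ≤ 2b`. -/
theorem weilIncrement_polyWitness_eq_ev (hp : isOddList p = true) (hb : 0 < b) {t : ℝ} (ht0 : 0 ≤ t)
    (ht : t ≤ 2 * b) : weilIncrement (polyWitness p b) t = ev (incrementL p b) t := by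
  rw [ev_incrementL, weilIncrement_polyWitness_eq hp hb ht0 ht]

/-- Sanity: the increment polynomial is non-negative on `[0, 2b]` (it is an `L²` increment). -/
theorem ev_incrementL_nonneg (hp : isOddList p = true) (hb : 0 < b) {t : ℝ} (ht0 : 0 ≤ t) (ht : t ≤ 2 * b) :
    0 ≤ ev (incrementL p b) t := by
  rw [← weilIncrement_polyWitness_eq_ev hp hb ht0 ht]
  exact weilIncrement_nonneg _ _

end Witness

/-! ## §C  Kernel regression tests (the lists reduce by `decide`) -/

/-- For `p = x` on `[−1, 1]`: `‖G‖² = 2/3`. -/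
example : LQ.normSq [0, 1] 1 = 2 / 3 := by decide +kernel

/-- For `p = x` on `[−1, 1]`: `D(0) = 0` and `D(2) = 2‖G‖² = 4/3` (disjoint supports). -/
example : LQ.evQ (incrementL [0, 1] 1) 0 = 0 ∧ LQ.evQ (incrementL [0, 1] 1) 2 = 4 / 3 := by decide +kernel

/-- For `p = x` on `[−1, 1]`: `κ(t) = ∫_{−1}^{1−t} (x+t)x dx = 2/3 − t + t³/6`, e.g. `κ(1) = −1/6 + 0 …`:
`κ(1) = ((0)^3/3 + 1·0^2/2) − (−1/3 + 1/2) = −1/6`. -/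
example : LQ.evQ (kappaL [0, 1] 1) 1 = -1 / 6 := by decide +kernel

/-- `x`, `x³ − x` are odd lists; `1 + x` is not. -/
example : LQ.isOddList [0, 1] = true ∧ LQ.isOddList [0, -1, 0, 1] = true ∧ LQ.isOddList [1, 1] = false := by
  decide +kernel

end Summit.RiemannHypothesis.RiemannHypothesis.Theorems.SemilocalPolyWitness
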